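import Literature.Probability.Percolation.QuadCrossingNoiseDiscrete
import HarnessLib

/-!
# Subsequential scaling limits of bond percolation in `ℋ_D` are probability measures

Topic `Probability/Percolation`; a short proofs file next to `QuadCrossingSpaceZ2.lean` (the laws
`μ_δ = z2QuadLaw D δ` of `ω ↦ S_ω ∈ ℋ_D` and the subsequential scaling limits
`IsSubseqQuadLimit D μ`, weak limits of `μ_{δ_k}` along `δ_k → 0⁺`, as `FiniteMeasure`s) and
`QuadCrossingNoiseDiscrete.lean` (`measurable_z2QuadConfig`: `ω ↦ S_ω` is Borel measurable for
`D` open and `δ > 0`, so `μ_δ` is a probability measure, `isProbabilityMeasure_z2QuadLaw_of_pos`).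
Passing to the limit: the total mass is continuous for weak convergence, so **every subsequential
scaling limit has total mass `1`, i.e. is a Borel probability measure on `(ℋ_D, 𝒯_D)`**, as in
the source (O. Schramm, S. Smirnov, *On the scaling limits of planar percolation*, Ann. Probab.
39 (2011), §1.3: "the scaling limit measure is a Borel probability measure on `ℋ`"; Cor. 1.6).
This is what consumers of Lemma 5.1 / Cor. 5.2 need to apply Mathlib's
`ProbabilityMeasure.tendsto_measure_of_null_frontier_of_tendsto`.

* `mass_z2QuadLaw` — `μ_δ` has total mass `1` (`D` open, `δ > 0`);
* `mass_eq_one_of_isSubseqQuadLimit`, `isProbabilityMeasure_of_isSubseqQuadLimit`.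

## References

* O. Schramm, S. Smirnov, Ann. Probab. 39 (2011) 1768–1814, arXiv:1101.5820, §1.3 and Cor. 1.6.
  [SchrammSmirnov2011]
-/

noncomputable section

open scoped NNReal ENNReal
open Set Filter
open _root_.MeasureTheory _root_.Topology
open Literature.Probability.LatticeModels

namespace Literature.Probability.Percolation

open QuadCrossing

variable {D : Set ℂ}

/-- The total mass of `μ_δ` is `1` (`D` open, `δ > 0`). [cite: SchrammSmirnov2011, §1.3] -/
theorem mass_z2QuadLaw (hD : IsOpen D) {δ : ℝ} (hδ : 0 < δ) : (z2QuadLaw D δ).mass = 1 := by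
  haveI := isProbabilityMeasure_z2QuadLaw_of_pos hD hδ
  have h : ((z2QuadLaw D δ).mass : ℝ≥0∞) = 1 := by
    rw [FiniteMeasure.ennreal_mass, measure_univ]
  exact_mod_cast h

/-- **Subsequential scaling limits have total mass one**: the total mass is continuous for weak
convergence (`Filter.Tendsto.mass`) and equals `1` along the approximating laws `μ_{δ_k}`
(`isSubseqQuadLimit_iff` puts the tree's `IsSubseqQuadLimit` in terms of `z2QuadLaw`).
[cite: SchrammSmirnov2011, Cor. 1.6] -/
theorem mass_eq_one_of_isSubseqQuadLimit (hD : IsOpen D) {μ : FiniteMeasure (QuadConfig D)}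
    (hμ : IsSubseqQuadLimit D μ) : μ.mass = 1 := by
  obtain ⟨δs, hpos, -, hlim⟩ := (isSubseqQuadLimit_iff D μ).mp hμ
  have hmass := hlim.mass
  have hconst : (fun k => (z2QuadLaw D (δs k)).mass) = fun _ => (1 : ℝ≥0) :=
    funext fun k => mass_z2QuadLaw hD (hpos k)
  rw [hconst] at hmass
  exact tendsto_nhds_unique hmass tendsto_const_nhds

/-- **Subsequential scaling limits are probability measures** on `(ℋ_D, 𝒯_D)` ("the scaling limit
measure is a Borel probability measure on `ℋ`"). [cite: SchrammSmirnov2011, §1.3 and Cor. 1.6] -/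
theorem isProbabilityMeasure_of_isSubseqQuadLimit (hD : IsOpen D)
    {μ : FiniteMeasure (QuadConfig D)} (hμ : IsSubseqQuadLimit D μ) :
    IsProbabilityMeasure (μ : Measure (QuadConfig D)) := by
  refine ⟨?_⟩
  rw [← FiniteMeasure.ennreal_mass, mass_eq_one_of_isSubseqQuadLimit hD hμ, ENNReal.coe_one]

end Literature.Probability.Percolation
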